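import Summits.RiemannHypothesis.RiemannHypothesis.Theorems.Splittings.ZdLocalReferencePins
import HarnessLib

/-!
# E3 — the L² floor: the prime pin at a SMALL co-growing scale is FALSE, unconditionally (zd-neg g10 §2c)

Cell rh-split, seat rh-split-zd-neg g10 (brief sha16 f79c5f09d8bcb036), card `run/shared/lean/pub/rh-split/cards/SPLIT-zd-neg.md` GEN-10
(N65–N68, R57–R61, B11–B12 + SUPPLEMENT); source `HOME/rh-split-zd-neg/SketchG10.lean` v2 sha16 29368ce59f30369a (namespace `RhSplitZdNegG10`),
referee rh-split-ref-2 g0: GEN-10 REPLAY PASS on kernel v2 + CONTENT read-backs R1–R10 + LABELS N65–N68 UPHELD (2026-08-27T09:34:25Z, `INBOX.md`);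
lead rh-split-lead g3; CARVE MAP + CUT.md in `HOME/rh-split-zd-neg/carve-g10/`.  Deltas vs the source (CUT.md): namespace ↦ `…Splittings.<lane>`, the scratch
abbreviations `FIN` / `H₀` SPELLED OUT (`riemannHypothesisUpTo_platt_trudgian` / `3000175332800`), the §0/§1 frame decls CITED from the tree
(`Splittings.ZdReferencePinsFrame`: `RHAbove`, `rh_of_fin_of_rhAbove`, `rhAbove_of_rh`, `two_le_count_jump`, `zetaArgS_sub`) instead of restated,
`primesLE_mono` ↦ Mathlib `Nat.primesLE_mono`, `abs_sin_sub_sin_le` privatised, docstrings added to helper decls; decl text otherwise byte-verbatim.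

This file: §2c `blockCoeff` and its bookkeeping, `im_dirichletSum_blockCoeff`, the headline `not_primePin_small_scale (r H) : ∃ a₀ > 0, ∀ a' ∈ (0, a₀],
¬ PrimePin a' r H` (tree Selberg mean square `(a, C)` + Montgomery–Vaughan + Mertens; FIN-free, standard axioms) and `exists_scale_not_primePin`.

HONEST LABEL: «SPLITTING SEARCH over kernel-typed RH-EQUIVALENCES; a splitting A ∧ B ⟹ RH is CONDITIONAL bookkeeping unless A and B are
both proved; nothing here bears on the truth of RH.»
-/

set_option linter.dupNamespace false

noncomputable section

open Filter Complex Metric Set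
open scoped Real Topology

namespace Summit.RiemannHypothesis.RiemannHypothesis.Theorems.Splittings.ZdPrimePin

open Literature.NumberTheory.DiophantineGeometry Literature.NumberTheory.LFunctions
  Literature.Barriers.RiemannHypothesis MeasureTheory
open Summit.RiemannHypothesis.RiemannHypothesis.Theorems.Splittings.ZdReferencePins (RHAbove
  rh_of_fin_of_rhAbove rhAbove_of_rh two_le_count_jump zetaArgS_sub)
open Summit.RiemannHypothesis.RiemannHypothesis.Theorems.Splittings.ZdTwoHeightMeanSquare (primeSin
  continuous_primeSin' im_sq_integral_ge primesLE_subset_Icc_sq sizes_aux intervalIntegrable_selbergE_sq)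

/-! ## §2c E3 — the L² floor: a prime pin at a SMALL co-growing scale is FALSE (unconditional)

If `|S + π⁻¹P_{N'}| < r` on `[U, 2U]` (`N' = ⌊(2U)^{a'}⌋₊`, the pin at `T = 2U`) while Selberg's
UNCONDITIONAL mean square gives `∫_U^{2U} (S + π⁻¹P_N)² ≤ 2CU` (`N = ⌊(4U)^a⌋₊`, tree-proved
`SelbergMeanSquare.approxFormula_meanSquare_of_zeroDensity SelbergDensity.selberg_zeroDensity_near_half`),
then the prime BLOCK `P_N − P_{N'} = −Im Σ_{N'<p≤N} p^{-1/2-iu}` has `∫_U^{2U} ≤ 2π²(2C + r²)U`,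
against `≥ (U/2)·Σ_{N'<p≤N} 1/p` (Dirichlet mean value theorem, tree `im_sq_integral_ge`) and
`Σ_{N'<p≤N} 1/p ≥ log(a/a') − 2K` (Mertens, tree): contradiction once `a' ≤ a·e^{−L}`,
`L = 8π²(2C + r²) + 2|K| + 1`.  The E2 template of g9 with a prime block in place of a dilation. -/

/-- Block coefficients: `(√p)⁻¹` at the primes `N' < p ≤ N`, `0` elsewhere. -/
def blockCoeff (N' N n : ℕ) : ℝ :=
  if n ∈ Nat.primesLE N \ Nat.primesLE N' then (Real.sqrt n)⁻¹ else 0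

/-- The block coefficients live on `n ≥ 2`. -/
theorem two_le_of_blockCoeff_ne_zero {N' N n : ℕ} (h : blockCoeff N' N n ≠ 0) : 2 ≤ n := by
  unfold blockCoeff at h
  by_cases h1 : n ∈ Nat.primesLE N \ Nat.primesLE N'
  · exact (Nat.mem_primesLE.1 (Finset.mem_sdiff.1 h1).1).2.two_le
  · simp [h1] at h

/-- The prime block `(N', N]` sits inside `[1, N²]`. -/
theorem sdiff_subset_Icc_sq (N' N : ℕ) :
    Nat.primesLE N \ Nat.primesLE N' ⊆ Finset.Icc 1 (N ^ 2) :=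
  Finset.sdiff_subset.trans (primesLE_subset_Icc_sq N)

/-- `∑_{n ≤ N²} ‖b_n‖² = ∑_{N' < p ≤ N} 1/p` for the block coefficients. -/
theorem sum_norm_sq_blockCoeff (N' N : ℕ) :
    ∑ n ∈ Finset.Icc 1 (N ^ 2), ‖(blockCoeff N' N n : ℂ)‖ ^ 2 =
      ∑ p ∈ Nat.primesLE N \ Nat.primesLE N', (p : ℝ)⁻¹ := by
  have e : ∀ n, ‖(blockCoeff N' N n : ℂ)‖ ^ 2 =
      if n ∈ Nat.primesLE N \ Nat.primesLE N' then (n : ℝ)⁻¹ else 0 := by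
    intro n
    rw [Complex.norm_real, Real.norm_eq_abs, sq_abs]
    unfold blockCoeff
    split_ifs with h
    · rw [inv_pow, Real.sq_sqrt (Nat.cast_nonneg _)]
    · simp
  simp_rw [e]
  rw [Finset.sum_ite_mem, Finset.inter_eq_right.2 (sdiff_subset_Icc_sq N' N)]

/-- `Im ∑_{n ≤ N²} b_n n^{-iu} = −(P_N(u) − P_{N'}(u))` (`N' ≤ N`). -/
theorem im_dirichletSum_blockCoeff {N' N : ℕ} (hN : N' ≤ N) (u : ℝ) :
    (∑ n ∈ Finset.Icc 1 (N ^ 2), (blockCoeff N' N n : ℂ) * (n : ℂ) ^ (-((u : ℂ) * I))).im =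
      -(primeSin N u - primeSin N' u) := by
  have hP0 : ∀ p ∈ Nat.primesLE N \ Nat.primesLE N', p ≠ 0 := fun p hp ↦
    (Nat.mem_primesLE.1 (Finset.mem_sdiff.1 hp).1).2.ne_zero
  have hsplit : ∀ n, (blockCoeff N' N n : ℂ) * (n : ℂ) ^ (-((u : ℂ) * I)) =
      (if n ∈ Nat.primesLE N \ Nat.primesLE N' then
        ((Real.sqrt n : ℝ) : ℂ)⁻¹ * (n : ℂ) ^ (-((u : ℂ) * I)) else 0) := by
    intro n
    unfold blockCoeff
    by_cases h1 : n ∈ Nat.primesLE N \ Nat.primesLE N' <;>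
      simp only [h1, if_true, if_false] <;> push_cast <;> ring
  simp_rw [hsplit]
  rw [Finset.sum_ite_mem, Finset.inter_eq_right.2 (sdiff_subset_Icc_sq N' N), Complex.im_sum]
  have h1 : ∀ p ∈ Nat.primesLE N \ Nat.primesLE N',
      (((Real.sqrt p : ℝ) : ℂ)⁻¹ * (p : ℂ) ^ (-((u : ℂ) * I))).im =
        -(Real.sin (u * Real.log p) / Real.sqrt p) := by
    intro p hp
    rw [natCast_cpow_neg_mul_I (hP0 p hp), ← Complex.ofReal_inv, Complex.im_ofReal_mul,
      Complex.exp_ofReal_mul_I_im, Real.sin_neg]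
    ring
  rw [Finset.sum_congr rfl h1, Finset.sum_neg_distrib]
  simp only [primeSin]
  rw [← Finset.sum_sdiff (Nat.primesLE_mono hN)]
  ring

/-- **E3 (the L² floor, unconditional).** For every radius `r` and height `H` there is
`a₀ = a₀(r) > 0` (from the tree's Selberg constants `a, C` and Mertens' `K`:
`a₀ = a·exp(−(8π²(2C + r²) + 2|K| + 1))`) such that `PrimePin a' r H` is FALSE for every scale
exponent `0 < a' ≤ a₀`: a pointwise explicit formula at a small co-growing scale would beat the
mean-square floor `(U/2)Σ_{(2U)^{a'} < p ≤ (4U)^{a}} 1/p ≍ U log(a/a')` of its own omitted prime block.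
No `RH`, no `riemannHypothesisUpTo_platt_trudgian`, no named fact. -/
theorem not_primePin_small_scale (r H : ℝ) :
    ∃ a₀ : ℝ, 0 < a₀ ∧ ∀ a' : ℝ, 0 < a' → a' ≤ a₀ → ¬ PrimePin a' r H := by
  -- (0) engine, thresholds, constants
  obtain ⟨a, b, ha, hab, hb, C', T₀, hAF'⟩ :=
    SelbergMeanSquare.approxFormula_meanSquare_of_zeroDensity
      SelbergDensity.selberg_zeroDensity_near_half
  obtain ⟨C, hC0, hAF⟩ : ∃ C : ℝ, 0 ≤ C ∧ ∀ T : ℝ, T₀ ≤ T → 0 ≤ T → ∀ y : ℝ, T ^ a ≤ y →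
      y ≤ T ^ b → ∫ t in T / 2..T, (zetaArgS t + π⁻¹ * primeSin ⌊y⌋₊ t) ^ 2 ≤ C * T :=
    ⟨max C' 0, le_max_right _ _, fun T hT hT0 y hy1 hy2 ↦ (hAF' T hT y hy1 hy2).trans
      (mul_le_mul_of_nonneg_right (le_max_left _ _) hT0)⟩
  obtain ⟨T₁, hT₁1, hthr⟩ := SelbergFujii.exists_threshold ha hab hb
  obtain ⟨K, hK⟩ := Mertens.abs_sum_primesLE_inv_sub_loglog_le 0
  have hπ : 0 < π := Real.pi_pos
  set L : ℝ := 8 * π ^ 2 * (2 * C + r ^ 2) + 2 * |K| + 1 with hL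
  have hL0 : 0 < L := by positivity
  refine ⟨a * Real.exp (-L), by positivity, fun a' ha' ha'le hB ↦ ?_⟩
  have hexp1 : Real.exp (-L) < 1 := Real.exp_lt_one_iff.2 (by linarith)
  have ha'a : a' < a := by nlinarith
  -- the height `U`
  obtain ⟨U, hUH, hU1, hUT₁, hUT₀, hUy'⟩ : ∃ U : ℝ, H ≤ 2 * U ∧ 1 ≤ U ∧ T₁ ≤ U ∧ T₀ ≤ 2 * U ∧
      (2 : ℝ) ≤ (2 * U) ^ a' := by
    set X : ℝ := (2 : ℝ) ^ (1 / a') with hXdef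
    have hX : 0 ≤ X := Real.rpow_nonneg (by norm_num) _
    set U := max (max (max H 1) (max T₁ T₀)) X with hUdef
    have hU1 : (1 : ℝ) ≤ U := (le_max_right H 1).trans ((le_max_left _ _).trans (le_max_left _ _))
    have hUH : H ≤ U := (le_max_left H 1).trans ((le_max_left _ _).trans (le_max_left _ _))
    have hUT₁ : T₁ ≤ U := (le_max_left T₁ T₀).trans ((le_max_right _ _).trans (le_max_left _ _))
    have hUT₀ : T₀ ≤ U := (le_max_right T₁ T₀).trans ((le_max_right _ _).trans (le_max_left _ _))
    have hUX : X ≤ U := le_max_right _ _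
    refine ⟨U, by linarith, hU1, hUT₁, by linarith, ?_⟩
    have h2U : X ≤ 2 * U := by linarith
    calc (2 : ℝ) = X ^ a' := by
          rw [hXdef, ← Real.rpow_mul (by norm_num : (0 : ℝ) ≤ 2), one_div_mul_cancel ha'.ne',
            Real.rpow_one]
      _ ≤ (2 * U) ^ a' := Real.rpow_le_rpow hX h2U ha'.le
  have hU0 : 0 < U := by linarith
  have h4U : (0 : ℝ) ≤ 4 * U := by linarith
  obtain ⟨h2a4a, h4a2b, h4a4b, hN250, hN4U⟩ := hthr U hUT₁
  -- the two polynomial lengths: `y = (4U)^a ≥ y' = (2U)^{a'}`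
  set y : ℝ := (4 * U) ^ a with hydef
  set N : ℕ := ⌊y⌋₊ with hNdef
  set y' : ℝ := (2 * U) ^ a' with hy'def
  set N' : ℕ := ⌊y'⌋₊ with hN'def
  have hy0 : 0 ≤ y := Real.rpow_nonneg h4U a
  have hN250' : (250 : ℝ) ≤ N := by exact_mod_cast hN250
  have hNy : (N : ℝ) ≤ y := Nat.floor_le hy0
  have hy2 : (2 : ℝ) ≤ y := by linarith
  have hy'y : y' ≤ y := by
    calc y' = (2 * U) ^ a' := rfl
      _ ≤ (2 * U) ^ a := Real.rpow_le_rpow_of_exponent_le (by linarith) ha'a.le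
      _ ≤ (4 * U) ^ a := h2a4a
  have hN'N : N' ≤ N := Nat.floor_le_floor hy'y
  -- Mertens at `y` and at `y'`
  have hKy := hK y hy2
  have hKy' := hK y' hUy'
  rw [pow_zero, div_one] at hKy hKy'
  rw [← hNdef] at hKy
  rw [← hN'def] at hKy'
  -- (1) the approximate formula on `[U, 2U]`
  have hE₁ : ∫ u in U..2 * U, (zetaArgS u + π⁻¹ * primeSin N u) ^ 2 ≤ C * (2 * U) := by
    have h := hAF (2 * U) hUT₀ (by linarith) y h2a4a h4a2b
    rwa [show (2 * U) / 2 = U by ring] at h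
  -- (2) pointwise on `[U, 2U]`: `(P_N − P_{N'})² ≤ 2π² (E₁² + r²)` (the pin at `T = 2U`)
  have hpt : ∀ u ∈ Icc U (2 * U), (primeSin N u - primeSin N' u) ^ 2 ≤
      2 * π ^ 2 * ((zetaArgS u + π⁻¹ * primeSin N u) ^ 2 + r ^ 2) := by
    intro u hu
    have hD := hB (2 * U) hUH u (by linarith [hu.1]) hu.2
    rw [← hy'def, ← hN'def, abs_lt] at hD
    have hM : primeSin N u - primeSin N' u =
        π * ((zetaArgS u + π⁻¹ * primeSin N u) - (zetaArgS u + π⁻¹ * primeSin N' u)) := by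
      field_simp
      ring
    rw [hM, mul_pow]
    have hz : (zetaArgS u + π⁻¹ * primeSin N' u) ^ 2 ≤ r ^ 2 := sq_le_sq' hD.1.le hD.2.le
    nlinarith [sq_nonneg ((zetaArgS u + π⁻¹ * primeSin N u) + (zetaArgS u + π⁻¹ * primeSin N' u)),
      mul_le_mul_of_nonneg_left hz (sq_nonneg π), sq_nonneg π]
  -- (3) integrate over `[U, 2U]`
  have hU2U : U ≤ 2 * U := by linarith
  have hi₁ : IntervalIntegrable (fun u ↦ (zetaArgS u + π⁻¹ * primeSin N u) ^ 2)
      volume U (2 * U) := by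
    simpa only [one_mul] using intervalIntegrable_selbergE_sq N one_pos hU2U
  have hPc := continuous_primeSin' N
  have hPc' := continuous_primeSin' N'
  have hMi : IntervalIntegrable (fun u ↦ (primeSin N u - primeSin N' u) ^ 2)
      volume U (2 * U) :=
    ((hPc.sub hPc').pow 2).intervalIntegrable _ _
  have hup : ∫ u in U..2 * U, (primeSin N u - primeSin N' u) ^ 2 ≤
      2 * π ^ 2 * (2 * C * U + r ^ 2 * U) := by
    calc ∫ u in U..2 * U, (primeSin N u - primeSin N' u) ^ 2
        ≤ ∫ u in U..2 * U, 2 * π ^ 2 * ((zetaArgS u + π⁻¹ * primeSin N u) ^ 2 + r ^ 2) :=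
          intervalIntegral.integral_mono_on hU2U hMi
            ((hi₁.add intervalIntegrable_const).const_mul _) hpt
      _ = 2 * π ^ 2 * ((∫ u in U..2 * U, (zetaArgS u + π⁻¹ * primeSin N u) ^ 2) +
            ((2 * U) - U) * r ^ 2) := by
          rw [intervalIntegral.integral_const_mul,
            intervalIntegral.integral_add hi₁ intervalIntegrable_const,
            intervalIntegral.integral_const, smul_eq_mul]
      _ ≤ 2 * π ^ 2 * (2 * C * U + r ^ 2 * U) :=
          mul_le_mul_of_nonneg_left (by nlinarith) (by positivity)
  -- (4) the lower bound from the Dirichlet mean value theorem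
  have hlow := im_sq_integral_ge (fun n ↦ (blockCoeff N' N n : ℂ)) (N ^ 2)
    (fun n _ hn ↦ two_le_of_blockCoeff_ne_zero (Complex.ofReal_ne_zero.1 hn)) U
  rw [sum_norm_sq_blockCoeff] at hlow
  simp_rw [im_dirichletSum_blockCoeff hN'N, neg_sq] at hlow
  push_cast at hlow
  have hsize := sizes_aux hN250 hN4U
  -- the block sum `W = V_N − V_{N'}`
  have hsd := Finset.sum_sdiff (Nat.primesLE_mono hN'N) (f := fun p ↦ ((p : ℕ) : ℝ)⁻¹)
  generalize hWgen : ∑ p ∈ Nat.primesLE N \ Nat.primesLE N', (p : ℝ)⁻¹ = W at hlow hsd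
  generalize hVgen : ∑ p ∈ Nat.primesLE N, (p : ℝ)⁻¹ = V at hKy hsd
  generalize hV'gen : ∑ p ∈ Nat.primesLE N', (p : ℝ)⁻¹ = V' at hKy' hsd
  have hW0 : 0 ≤ W := by
    rw [← hWgen]
    exact Finset.sum_nonneg fun p _ ↦ inv_nonneg.2 (Nat.cast_nonneg _)
  -- (5) `(U/2)·W ≤ U·W − (…)·W ≤ 2∫ ≤ 4π²(2C + r²)U`, so `W ≤ 8π²(2C + r²)`
  have hWle : W ≤ 8 * π ^ 2 * (2 * C + r ^ 2) := by
    have hA := mul_le_mul_of_nonneg_right hsize hW0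
    have h1 : U * W ≤ U * (8 * π ^ 2 * (2 * C + r ^ 2)) := by linarith [hlow, hup, hA]
    exact le_of_mul_le_mul_left h1 hU0
  -- (6) Mertens twice: `W = V − V' ≥ log log y − log log y' − 2K ≥ log(a/a') − 2K ≥ L − 2K`
  have hlog4U : 0 < Real.log (4 * U) := Real.log_pos (by linarith)
  have hlog2U : 0 < Real.log (2 * U) := Real.log_pos (by linarith)
  have hlogy : Real.log (Real.log y) = Real.log a + Real.log (Real.log (4 * U)) := by
    rw [hydef, Real.log_rpow (by linarith), Real.log_mul ha.ne' hlog4U.ne']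
  have hlogy' : Real.log (Real.log y') = Real.log a' + Real.log (Real.log (2 * U)) := by
    rw [hy'def, Real.log_rpow (by linarith), Real.log_mul ha'.ne' hlog2U.ne']
  have hll : Real.log (Real.log (2 * U)) ≤ Real.log (Real.log (4 * U)) :=
    Real.log_le_log hlog2U (Real.log_le_log (by linarith) (by linarith))
  have hla' : Real.log a' ≤ Real.log a - L := by
    have h1 := Real.log_le_log ha' ha'le
    rwa [Real.log_mul ha.ne' (Real.exp_pos _).ne', Real.log_exp] at h1
  rw [abs_le] at hKy hKy'
  have hWV : W = V - V' := by linarith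
  linarith [hKy.1, hKy'.2, le_abs_self K, neg_abs_le K, hlogy, hlogy', hll, hla', hWle, hWV, hL]

/-- Hence, for every `r` and `H`: prime pins FAIL below the scale `a₀(r)` — in particular the
splitting `riemannHypothesisUpTo_platt_trudgian ∧ PrimePin a 1 3000175332800 → RH` (`rh_of_fin_of_primePin`) has a FALSE conjunct for all
small `a`; the pins at scales `a > a₀(1)` are the residue N68⁺ (undecided; see the card). -/
theorem exists_scale_not_primePin (r H : ℝ) : ∃ a : ℝ, 0 < a ∧ ¬ PrimePin a r H := by
  obtain ⟨a₀, ha₀, h⟩ := not_primePin_small_scale r H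
  exact ⟨a₀, ha₀, h a₀ ha₀ le_rfl⟩

end Summit.RiemannHypothesis.RiemannHypothesis.Theorems.Splittings.ZdPrimePin

end
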